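import Literature.NumberTheory.GaloisRepresentations.LubinTateColemanRelativeExactPrincipalTwo
import Literature.NumberTheory.GaloisRepresentations.LubinTateColemanUnitsImageEquivTwo
import HarnessLib

/-!
# A norm-coherent unit along `E·K_π^{m+1}` that is principal at level `0` is principal at EVERY level:
# `‖β_0 − 1‖ < 1 ⟹ ‖β_m − 1‖ < 1` (de Shalit I §2.2: `β_m = ((φ⁻¹)^{m+1} g_β)(ω_{m+1}) ≡ φ^{−(m+1)}(g_β(0))`; `q = 2`, unramified base)

Topic `NumberTheory/GaloisRepresentations`; namespace `Literature.NumberTheory.GaloisRepresentations`.  The tree's two-variable Coleman theory calls a norm-coherent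
`β ∈ RelNormCoherentUnits hπ E` PRINCIPAL when `‖β_0 − 1‖ < 1` (`principalCoherentFamilies`, `LubinTateColemanRelativeExactPrincipalTwo`); Rubin's `U_∞ = lim← U¹`
consists of families that are principal units at EVERY level.  The two notions agree: by Coleman interpolation (`evS_relColemanSeries`: `β_m` is the value of
`(φ⁻¹)^{m+1} g_β` at the torsion point `ω_{m+1} ∈ 𝔪`), `β_m ≡ φ^{−(m+1)}(g_β(0))` modulo the maximal ideal (`norm_evS_map_sub_constantCoeff_le`), and `φ` is an
isometry; so `β_0 ≡ 1` forces `g_β(0) ≡ 1` and then `β_m ≡ 1` for all `m`.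

* `constantCoeff_iterate_map` (constant terms of twisted series), `norm_coe_frobUnitBall_symm_pow_sub_one` (`‖(φ⁻¹)^k c − 1‖ = ‖c − 1‖`);
* ★ `RelNormCoherentUnits.norm_val_sub_constantCoeff_lt_one` — `‖β_m − ι(φ^{−(m+1)} g_β(0))‖ < 1`;
* ★★ **`RelNormCoherentUnits.norm_val_sub_one_lt_one_of_zero`** — `‖β_0 − 1‖ < 1 ⟹ ∀ m, ‖β_m − 1‖ < 1`;
* ★ `norm_val_sub_one_lt_one_of_mem_principalCoherentFamilies` — for `β ∈ principalCoherentFamilies hπ E hmono`, EVERY component `β_{i,k}` is a principal unit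
  (so the diagonal `β_{n,n}` is: the `𝔓`-component of Rubin's `U¹_∞`, `EllipticCurves/PAdicTwoVariableLocalUnitsDiagonal`).

Hypotheses as in the lane: `|𝓀_F| = 2` (`hq`), `E ≤ F^{nr}` finite Galois (`hE`), an arithmetic Frobenius `σ₀` (`hσ₀`).  Theorems only; no `sorry`.

## References
* [deShalit1987] E. de Shalit, *Iwasawa theory of elliptic curves with complex multiplication* (1987), Ch. I §2.2 Theorem, §3.3, §3.8 (17).
* [SerreLocalFields1979] J.-P. Serre, *Local Fields* (1979), Ch. II §2 Cor. 3.
-/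

noncomputable section

open scoped PowerSeries.WithPiTopology

namespace Literature.NumberTheory.GaloisRepresentations

section PrincipalLevels

open GaloisRepresentations.IsNonarchimedeanLocalField LubinTate ValuativeRel Field

variable {F : Type} [Field F] [ValuativeRel F] [TopologicalSpace F] [IsNonarchimedeanLocalField F]

attribute [local instance] ltNormUniformSpace ltNormIsUniformAddGroup rk1 nF nE fintypeResidueField

variable {π : 𝒪[F]} (hπ : (valuation F).IsUniformizer (π : F))
variable (E : IntermediateField F (AlgebraicClosure F)) [FiniteDimensional F E]

/-- Constant terms of twisted series: `((map ψ)^[k] G)(0) = ψ^k (G(0))`. [cite: deShalit1987, Ch. I §2.2] -/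
theorem constantCoeff_iterate_map (ψ : unitBall E →+* unitBall E) (k : ℕ) (G : PowerSeries (unitBall E)) :
    PowerSeries.constantCoeff ((PowerSeries.map ψ)^[k] G) = (ψ ^ k) (PowerSeries.constantCoeff G) := by
  induction k generalizing G with
  | zero => rfl
  | succ k ih =>
      rw [Function.iterate_succ_apply, ih, pow_succ, RingHom.mul_def, RingHom.comp_apply, ← PowerSeries.coeff_zero_eq_constantCoeff_apply,
        PowerSeries.coeff_map, PowerSeries.coeff_zero_eq_constantCoeff_apply]

variable [Normal F E]

/-- `‖(φ⁻¹)^k c − 1‖ = ‖c − 1‖`: the powers of the inverse Frobenius of `𝒪_E` are isometries fixing `1`. [cite: SerreLocalFields1979, Ch. II §2 Cor. 3] -/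
theorem norm_coe_frobUnitBall_symm_pow_sub_one (σ₀ : absoluteGaloisGroup F) (k : ℕ) (c : unitBall E) :
    ‖(((((frobUnitBall E σ₀).symm : unitBall E →+* unitBall E) ^ k) c : unitBall E) : E) - 1‖ = ‖(c : E) - 1‖ := by
  have h : (((((frobUnitBall E σ₀).symm : unitBall E →+* unitBall E) ^ k) c : unitBall E) : E) - 1 =
      (((((frobUnitBall E σ₀).symm : unitBall E →+* unitBall E) ^ k) (c - 1) : unitBall E) : E) := by
    rw [map_sub, map_one, AddSubgroupClass.coe_sub, OneMemClass.coe_one]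
  have e2 : (c : E) - 1 = ((c - 1 : unitBall E) : E) := by rw [AddSubgroupClass.coe_sub, OneMemClass.coe_one]
  rw [h, e2]
  exact norm_ringHom_pow E (fun c => norm_unitBallEquiv E ((absoluteGaloisGroup.toAlgEquiv F σ₀).restrictNormal E).symm c) k (c - 1)

variable [IsGalois F E]

/-- ★ **`β_m ≡ φ^{−(m+1)}(g_β(0))` modulo the maximal ideal**: `‖β_m − ι((φ⁻¹)^{m+1} g_β(0))‖ < 1` (`β_m` is the value at the torsion point `ω_{m+1} ∈ 𝔪` of
`(φ⁻¹)^{m+1} g_β`, whose value differs from the constant term by an element of norm `≤ ‖ω_{m+1}‖ < 1`). [cite: deShalit1987, Ch. I §2.2 Theorem] -/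
theorem RelNormCoherentUnits.norm_val_sub_constantCoeff_lt_one (hq : residueFieldCard F = 2) (hE : E ≤ maxUnramified F) {σ₀ : absoluteGaloisGroup F}
    (hσ₀ : IsAbsArithFrob σ₀) (β : RelNormCoherentUnits hπ E) (m : ℕ) :
    ‖((β.val m : unitBall (E ⊔ ltField π m : IntermediateField F (AlgebraicClosure F))) : (E ⊔ ltField π m : IntermediateField F (AlgebraicClosure F))) -
        ((inclUnitBall (F := F) (le_sup_left : E ≤ E ⊔ ltField π m)
          ((((frobUnitBall E σ₀).symm : unitBall E →+* unitBall E) ^ (m + 1)) (PowerSeries.constantCoeff (relColemanSeries hπ E hq hE hσ₀ β))) :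
            unitBall (E ⊔ ltField π m : IntermediateField F (AlgebraicClosure F))) : (E ⊔ ltField π m : IntermediateField F (AlgebraicClosure F)))‖ < 1 := by
  have h := norm_evS_map_sub_constantCoeff_le E (le_sup_left : E ≤ E ⊔ ltField π m)
    ((PowerSeries.map ((frobUnitBall E σ₀).symm : unitBall E →+* unitBall E))^[m + 1] (relColemanSeries hπ E hq hE hσ₀ β))
    (inclPt (le_sup_right : ltField π m ≤ E ⊔ ltField π m) (cohPt hπ m))
  rw [evS_relColemanSeries hπ E hq hE hσ₀ β m, constantCoeff_iterate_map] at h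
  exact h.trans_lt (inclPt (le_sup_right : ltField π m ≤ E ⊔ ltField π m) (cohPt hπ m)).2

/-- ★★ **Principal at level `0` ⟹ principal at every level**: if `‖β_0 − 1‖ < 1` then `‖β_m − 1‖ < 1` for all `m`.  (`‖β_0 − ιφ⁻¹(g_β(0))‖ < 1` and `‖β_0 − 1‖ < 1`
give `‖g_β(0) − 1‖ < 1` by the ultrametric inequality and the isometry `φ`; then `‖β_m − 1‖ ≤ max(‖β_m − ι c_m‖, ‖c_m − 1‖) < 1` with `c_m = φ^{−(m+1)} g_β(0)`.)
[cite: deShalit1987, Ch. I §2.2 Theorem, §3.3] [cite: SerreLocalFields1979, Ch. II §2 Cor. 3] -/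
theorem RelNormCoherentUnits.norm_val_sub_one_lt_one_of_zero (hq : residueFieldCard F = 2) (hE : E ≤ maxUnramified F) {σ₀ : absoluteGaloisGroup F}
    (hσ₀ : IsAbsArithFrob σ₀) (β : RelNormCoherentUnits hπ E)
    (h0 : ‖((β.val 0 : unitBall (E ⊔ ltField π 0 : IntermediateField F (AlgebraicClosure F))) : (E ⊔ ltField π 0 : IntermediateField F (AlgebraicClosure F))) - 1‖ < 1)
    (m : ℕ) :
    ‖((β.val m : unitBall (E ⊔ ltField π m : IntermediateField F (AlgebraicClosure F))) : (E ⊔ ltField π m : IntermediateField F (AlgebraicClosure F))) - 1‖ < 1 := by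
  set G := relColemanSeries hπ E hq hE hσ₀ β with hG
  set c : ℕ → unitBall E := fun k ↦ (((frobUnitBall E σ₀).symm : unitBall E →+* unitBall E) ^ (k + 1)) (PowerSeries.constantCoeff G) with hc
  -- `‖ι c_k − 1‖ = ‖G(0) − 1‖` at every level
  have hnorm : ∀ k, ‖((inclUnitBall (F := F) (le_sup_left : E ≤ E ⊔ ltField π k) (c k) : unitBall (E ⊔ ltField π k : IntermediateField F (AlgebraicClosure F))) :
      (E ⊔ ltField π k : IntermediateField F (AlgebraicClosure F))) - 1‖ = ‖((PowerSeries.constantCoeff G : unitBall E) : E) - 1‖ := by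
    intro k
    have e : ((inclUnitBall (F := F) (le_sup_left : E ≤ E ⊔ ltField π k) (c k) : unitBall (E ⊔ ltField π k : IntermediateField F (AlgebraicClosure F))) :
        (E ⊔ ltField π k : IntermediateField F (AlgebraicClosure F))) - 1 =
        ((inclUnitBall (F := F) (le_sup_left : E ≤ E ⊔ ltField π k) (c k - 1) : unitBall (E ⊔ ltField π k : IntermediateField F (AlgebraicClosure F))) :
          (E ⊔ ltField π k : IntermediateField F (AlgebraicClosure F))) := by
      rw [map_sub, map_one, AddSubgroupClass.coe_sub, OneMemClass.coe_one]
    rw [e, norm_inclUnitBall, AddSubgroupClass.coe_sub, OneMemClass.coe_one, hc]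
    exact norm_coe_frobUnitBall_symm_pow_sub_one E σ₀ (k + 1) _
  -- level `0`: `‖G(0) − 1‖ < 1`
  have hβc := β.norm_val_sub_constantCoeff_lt_one hπ E hq hE hσ₀
  have hG1 : ‖((PowerSeries.constantCoeff G : unitBall E) : E) - 1‖ < 1 := by
    rw [← hnorm 0]
    have htri := IsUltrametricDist.norm_add_le_max
      (((inclUnitBall (F := F) (le_sup_left : E ≤ E ⊔ ltField π 0) (c 0) : unitBall (E ⊔ ltField π 0 : IntermediateField F (AlgebraicClosure F))) :
        (E ⊔ ltField π 0 : IntermediateField F (AlgebraicClosure F))) -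
        ((β.val 0 : unitBall (E ⊔ ltField π 0 : IntermediateField F (AlgebraicClosure F))) : (E ⊔ ltField π 0 : IntermediateField F (AlgebraicClosure F))))
      (((β.val 0 : unitBall (E ⊔ ltField π 0 : IntermediateField F (AlgebraicClosure F))) : (E ⊔ ltField π 0 : IntermediateField F (AlgebraicClosure F))) - 1)
    rw [sub_add_sub_cancel] at htri
    refine htri.trans_lt (max_lt ?_ h0)
    rw [norm_sub_rev]
    exact hβc 0
  -- level `m`
  have htri := IsUltrametricDist.norm_add_le_max
    (((β.val m : unitBall (E ⊔ ltField π m : IntermediateField F (AlgebraicClosure F))) : (E ⊔ ltField π m : IntermediateField F (AlgebraicClosure F))) -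
      ((inclUnitBall (F := F) (le_sup_left : E ≤ E ⊔ ltField π m) (c m) : unitBall (E ⊔ ltField π m : IntermediateField F (AlgebraicClosure F))) :
        (E ⊔ ltField π m : IntermediateField F (AlgebraicClosure F))))
    (((inclUnitBall (F := F) (le_sup_left : E ≤ E ⊔ ltField π m) (c m) : unitBall (E ⊔ ltField π m : IntermediateField F (AlgebraicClosure F))) :
      (E ⊔ ltField π m : IntermediateField F (AlgebraicClosure F))) - 1)
  rw [sub_add_sub_cancel] at htri
  refine htri.trans_lt (max_lt (hβc m) ?_)
  rw [hnorm m]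
  exact hG1

end PrincipalLevels

/-! ### Principal coherent families are principal at every index -/

section Families

open GaloisRepresentations.IsNonarchimedeanLocalField LubinTate ValuativeRel Field

variable {F : Type} [Field F] [ValuativeRel F] [TopologicalSpace F] [IsNonarchimedeanLocalField F]

attribute [local instance] ltNormUniformSpace ltNormIsUniformAddGroup rk1 nF nE fintypeResidueField

variable {π : 𝒪[F]} (hπ : (valuation F).IsUniformizer (π : F))
  (E : ℕ → IntermediateField F (AlgebraicClosure F)) [∀ m, FiniteDimensional F (E m)] [∀ m, Normal F (E m)] [∀ m, IsGalois F (E m)]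
  (hmono : Monotone E) (hq : residueFieldCard F = 2) (hE : ∀ m, E m ≤ maxUnramified F) {σ₀ : absoluteGaloisGroup F} (hσ₀ : IsAbsArithFrob σ₀)

include hq hE hσ₀ in
/-- ★ **Every component `β_{i,k}` of a principal coherent family is a principal unit** (`principalCoherentFamilies` records `‖β_{i,0} − 1‖ < 1`; by
`norm_val_sub_one_lt_one_of_zero` this propagates to all `k`).  In particular the diagonal `(β_{n,n})_n` consists of principal units — the image of
`principalCoherentFamilies` in Rubin's `U_∞` at one prime is `lim← U¹`. [cite: deShalit1987, Ch. I §3.8 (17), III.1.3 (p. 90)] -/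
theorem norm_val_sub_one_lt_one_of_mem_principalCoherentFamilies {β : ∀ m, RelNormCoherentUnits hπ (E m)}
    (hβ : β ∈ principalCoherentFamilies hπ E hmono) (i k : ℕ) :
    ‖(((β i).val k : unitBall (E i ⊔ ltField π k : IntermediateField F (AlgebraicClosure F))) : (E i ⊔ ltField π k : IntermediateField F (AlgebraicClosure F))) - 1‖ < 1 :=
  (β i).norm_val_sub_one_lt_one_of_zero hπ (E i) hq (hE i) hσ₀ (hβ.2 i) k

end Families

end Literature.NumberTheory.GaloisRepresentations

end
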